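import Literature.Geometry.Symplectic.JHolomorphicLimitEmbedded
import Literature.Geometry.Symplectic.JHolomorphicLocalIntersections
import Literature.Geometry.Symplectic.JHolomorphicIntersectionDichotomy
import Literature.Geometry.Symplectic.JHolomorphicReparametrisation
import Literature.Geometry.Symplectic.JHolomorphicCriticalPointsIsolated
import Literature.Geometry.Symplectic.JHolomorphicLocalIntersectionsProofs
import Mathlib.Geometry.Manifold.ContMDiff.NormedSpace
import Mathlib.Analysis.Normed.Module.Ball.Homeomorph
import Mathlib.Analysis.Normed.Module.Connected
import Mathlib.Analysis.Calculus.InverseFunctionTheorem.FDeriv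
import Mathlib.Analysis.Convex.Topology
import Mathlib.LinearAlgebra.FiniteDimensional.Lemmas

/-!
# McDuff's limit theorem for embedded `J`-planes from the local facts (the reduction)

Sibling "Proofs" file of `JHolomorphicLimitEmbedded.lean`. The named fact
`Literature.Geometry.Symplectic.jHolomorphicLimitOfEmbedded_isEmbedded` (D. McDuff, *The local
behaviour of holomorphic curves in almost complex 4-manifolds*, J. Differential Geom. 34 (1991),
§4: a locally uniform limit `G` of embedded `J`-holomorphic planes which embeds a separating
collar `r₀ < |ξ| < r₁` is an injective immersion on `|ξ| < r₁`) is reduced here to the LOCAL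
named facts of `JHolomorphicLocalIntersections.lean`:

* `jHolomorphicLimitOfEmbedded_isEmbedded_of_local` — GIVEN unique continuation from open sets
  (`jHolomorphic_uniqueContinuation_const`, McDuff Lemma 2.3), the local branch dichotomy
  (`jHolomorphic_localBranchDichotomy`, Wendl Thm 2.88), the persistence of isolated
  intersections (`jHolomorphic_isolatedIntersection_persists`, McDuff Thm 1.1 / (5.1)) and the
  absence of cusps in limits of embedded curves
  (`jHolomorphic_immersed_of_limitEmbedded_punctured`, McDuff Thm 1.4 / Cor. 4.4), the fact
  `jHolomorphicLimitOfEmbedded_isEmbedded` holds. The fifth local input, the intersection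
  dichotomy `jHolomorphic_intersectionDichotomy` (McDuff Lemma 2.7), is already a theorem of the
  tree (`jHolomorphic_intersectionDichotomy_holds`, `JHolomorphicIntersectionDichotomy.lean`) and
  is used, not assumed.

The argument is the elementary topology of McDuff's §4–§5 once the local contributions are
known to be positive ((5.5), p. 163: every double point and every critical point of a curve
which is not multiply covered contributes positively to the self-intersection number, which
vanishes for limits of embedded curves): all pairs of distinct points of the disc
`B = ball 0 r₁` with the same image lie in the inner closed disc `closedBall 0 r₀` (collar
injectivity and separation). Let `N ⊆ closedBall 0 r₀` be the set of points of `B` having a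
distinct partner in `B` with the same image.
(i) `N` is open: at a regular point `t ∈ N` with partner `s`, the branches of `G` at `s` and `t`
either meet in isolation — then the embedded approximants `uₙ(· + s)`, `uₙ(· + t)` meet for large
`n` (persistence), contradicting the injectivity of `uₙ` — or have the same image germ, so every
point near `t` has a partner near `s`; a critical point of `G` is of branched type (an injective
critical germ is excluded by the no-cusp fact applied to `G(· + c)` and the `uₙ(· + c)`), so a
punctured neighbourhood of it lies in `N`.
(ii) `closure N` is open as well: a point of `closure N ∖ N` is not locally injective (limits of
partner pairs, compactness of the inner closed disc), hence critical (an immersed point is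
locally injective), hence branched.
So `closure N` is clopen in the connected disc and misses the collar point `(r₀ + r₁)/2`: it is
empty, `G` is injective on the disc, and a critical point would create points of `N`. Unique
continuation is only used to know that `G` is nowhere locally constant (else `dG ≡ 0`,
contradicting the immersed collar).

* `jHolomorphicLimitOfEmbedded_isEmbedded_of_persist_of_noCusp` — the same conclusion from
  FEWER local facts: only the persistence of isolated intersections
  (`jHolomorphic_isolatedIntersection_persists`) and the absence of cusps
  (`jHolomorphic_immersed_of_limitEmbedded_punctured`) are assumed; unique continuation
  (`jHolomorphic_uniqueContinuation_const_holds`), the intersection dichotomy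
  (`jHolomorphic_intersectionDichotomy_holds`) and the isolatedness of critical points
  (`IsJHolomorphic.eventually_injective_mfderiv`, McDuff Lemma 2.7,
  `JHolomorphicCriticalPointsIsolated.lean`) are theorems of the tree, and the local branch
  dichotomy (`jHolomorphic_localBranchDichotomy`, Wendl Thm 2.88 — whose printed proof rests on the
  representation formula) is NOT used. Argument: the critical points of `G` in the disc form a
  finite set `Z` (isolated, closed, inside the compact inner disc); on the connected set `B ∖ Z`
  of regular points of the disc the locus `N₂` of regular points having a distinct partner in `B`
  is open (intersection dichotomy at a regular point against any branch + persistence) and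
  relatively closed (limits of partners; a regular point is locally injective), and misses the
  collar, so it is empty; a critical point `c` then has no regular partner, so `G` is injective on
  a disc about `c` and immersive on the punctured disc, and the no-cusp fact makes `c` regular:
  there are no critical points, and injectivity follows.

Also here (namespace `Literature.Geometry.Symplectic.LimitEmbedded`): shifts `z ↦ f (z + c)` of
smooth / `J`-holomorphic maps `ℂ → V` (smoothness, `J`-holomorphicity, differential, transfer of
locally uniform convergence through `ι` to closed discs), and
`exists_injOn_ball_of_mfderiv_injective`: a `C^∞` map `ℂ → V` with injective differential at
`t` is injective on a disc about `t` (inverse function theorem for `P ∘ ι ∘ G`, `P` a linear left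
inverse of the injective derivative of `ι ∘ G`). This is the Literature-side home of the
reduction first written on the summit side
(`Summits/SmoothPoincare4/SmoothPoincare4/Theorems/SullivanDualWitnessChargeLimitEmbeddedLocal*.lean`,
which Literature may not import), with the intersection dichotomy discharged.

## References

* D. McDuff, *The local behaviour of holomorphic curves in almost complex 4-manifolds*,
  J. Differential Geom. 34 (1991) 143–164: Lemma 2.3 (p. 147), Lemma 2.7 (p. 150), Thm 1.1
  (p. 143), Thm 1.4 (p. 144), §4 (Def. 4.1, Lemmas 4.2–4.3, Cor. 4.4), §5 ((5.1), (5.5)).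
  [McDuff1991LocalBehaviour]
* C. Wendl, *Lectures on Holomorphic Curves in Symplectic and Contact Geometry*
  (arXiv:1011.1690), Thm 2.88. [WendlLectures2010]
-/

noncomputable section

open scoped Manifold ContDiff Topology
open Set Filter

namespace Literature.Geometry.Symplectic

namespace LimitEmbedded

section Shifts

variable {V : Type} [TopologicalSpace V] [ChartedSpace (EuclideanSpace ℝ (Fin 4)) V]

/-! ### Shifts `z ↦ f (z + c)` of smooth / `J`-holomorphic maps `ℂ → V` -/

/-- Translation `z ↦ z + c` of `ℂ` is `C^∞`. [folklore] -/
theorem contMDiff_add_const (c : ℂ) : ContMDiff 𝓘(ℝ, ℂ) 𝓘(ℝ, ℂ) ∞ (fun z : ℂ => z + c) :=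
  contMDiff_iff_contDiff.2 (contDiff_id.add contDiff_const)

/-- A shift of a `C^∞` map `ℂ → V` is `C^∞`. [folklore] -/
theorem contMDiff_comp_add_const {f : ℂ → V} (hf : ContMDiff 𝓘(ℝ, ℂ) (𝓡 4) ∞ f) (c : ℂ) :
    ContMDiff 𝓘(ℝ, ℂ) (𝓡 4) ∞ (fun z : ℂ => f (z + c)) :=
  hf.comp (contMDiff_add_const c)

/-- A shift of a smooth `J`-holomorphic map is `J`-holomorphic. [folklore] -/
theorem isJHolomorphic_comp_add_const
    {J : ∀ x : V, TangentSpace (𝓡 4) x →L[ℝ] TangentSpace (𝓡 4) x}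
    {f : ℂ → V} (hf : ContMDiff 𝓘(ℝ, ℂ) (𝓡 4) ∞ f) (hJ : IsJHolomorphic (𝓡 4) J f) (c : ℂ) :
    IsJHolomorphic (𝓡 4) J (fun z : ℂ => f (z + c)) := by
  have h := hJ.comp_affine (fun z => (hf z).mdifferentiableAt (by simp)) 1 c
  have e : (f ∘ fun z => (1 : ℂ) * z + c) = fun z => f (z + c) :=
    funext fun z => by simp only [Function.comp_apply, one_mul]
  rwa [e] at h

/-- The differential of a shift: `d(f(· + c))(z₀) = df(z₀ + c)`. [folklore] -/
theorem mfderiv_comp_add_const {f : ℂ → V} (hf : ContMDiff 𝓘(ℝ, ℂ) (𝓡 4) ∞ f) (c z₀ : ℂ) :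
    mfderiv 𝓘(ℝ, ℂ) (𝓡 4) (fun z : ℂ => f (z + c)) z₀ = mfderiv 𝓘(ℝ, ℂ) (𝓡 4) f (z₀ + c) := by
  have htr : HasMFDerivAt 𝓘(ℝ, ℂ) 𝓘(ℝ, ℂ) (fun z : ℂ => z + c) z₀
      (ContinuousLinearMap.id ℝ ℂ) :=
    ((hasFDerivAt_id z₀).add_const c).hasMFDerivAt
  have hf' : HasMFDerivAt 𝓘(ℝ, ℂ) (𝓡 4) f (z₀ + c) (mfderiv 𝓘(ℝ, ℂ) (𝓡 4) f (z₀ + c)) :=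
    ((hf (z₀ + c)).mdifferentiableAt (by simp)).hasMFDerivAt
  have hcomp : HasMFDerivAt 𝓘(ℝ, ℂ) (𝓡 4) (fun z : ℂ => f (z + c)) z₀
      ((mfderiv 𝓘(ℝ, ℂ) (𝓡 4) f (z₀ + c)).comp (ContinuousLinearMap.id ℝ ℂ)) :=
    hf'.comp z₀ htr
  exact hcomp.mfderiv.trans (ContinuousLinearMap.comp_id _)

/-- Locally uniform convergence through `ι` transfers to shifts, on closed discs. [folklore] -/
theorem tendstoUniformlyOn_comp_add_const {W X : Type*} [PseudoMetricSpace X] {ι : W → X}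
    {u : ℕ → ℂ → W} {G : ℂ → W}
    (h : ∀ D : Set ℂ, IsCompact D →
      TendstoUniformlyOn (fun n ζ => ι (u n ζ)) (fun ζ => ι (G ζ)) atTop D)
    (c : ℂ) (ρ : ℝ) :
    TendstoUniformlyOn (fun n z => ι (u n (z + c))) (fun z => ι (G (z + c))) atTop
      (Metric.closedBall (0 : ℂ) ρ) := by
  have h1 := (h (Metric.closedBall c ρ) (isCompact_closedBall c ρ)).comp (fun z : ℂ => z + c)
  refine h1.mono ?_
  intro z hz
  simp only [Set.mem_preimage, Metric.mem_closedBall, dist_eq_norm, add_sub_cancel_right]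
  simpa [Metric.mem_closedBall, dist_eq_norm] using hz

end Shifts

/-! ### An immersed point is a locally injective point -/

/-- **A `C^∞` map `ℂ → V` with injective differential at `t` is injective near `t`** (read
through a smooth immersion `ι : V → ℝᴺ` with injective differentials: `ι ∘ G` has injective
derivative at `t`; compose with a linear left inverse and apply the inverse function theorem).
[folklore] -/
theorem exists_injOn_ball_of_mfderiv_injective
    {V : Type} [TopologicalSpace V] [ChartedSpace (EuclideanSpace ℝ (Fin 4)) V]
    {N : ℕ} {ι : V → EuclideanSpace ℝ (Fin N)}
    (hιs : ContMDiff (𝓡 4) 𝓘(ℝ, EuclideanSpace ℝ (Fin N)) ∞ ι)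
    (hιd : ∀ x : V, Function.Injective (mfderiv (𝓡 4) 𝓘(ℝ, EuclideanSpace ℝ (Fin N)) ι x))
    {G : ℂ → V} (hG : ContMDiff 𝓘(ℝ, ℂ) (𝓡 4) ∞ G) {t : ℂ}
    (ht : Function.Injective (mfderiv 𝓘(ℝ, ℂ) (𝓡 4) G t)) :
    ∃ ρ : ℝ, 0 < ρ ∧ Set.InjOn G (Metric.ball t ρ) := by
  set F : ℂ → EuclideanSpace ℝ (Fin N) := fun z => ι (G z) with hF
  have hFs : ContMDiff 𝓘(ℝ, ℂ) 𝓘(ℝ, EuclideanSpace ℝ (Fin N)) ∞ F := hιs.comp hG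
  have hFd : ContDiff ℝ ∞ F := contMDiff_iff_contDiff.1 hFs
  -- the derivative of `F` at `t` is injective
  have hmf : mfderiv 𝓘(ℝ, ℂ) 𝓘(ℝ, EuclideanSpace ℝ (Fin N)) F t =
      (mfderiv (𝓡 4) 𝓘(ℝ, EuclideanSpace ℝ (Fin N)) ι (G t)).comp
        (mfderiv 𝓘(ℝ, ℂ) (𝓡 4) G t) :=
    mfderiv_comp t ((hιs (G t)).mdifferentiableAt (by simp)) ((hG t).mdifferentiableAt (by simp))
  have hLinj : Function.Injective (fderiv ℝ F t) := by
    rw [← mfderiv_eq_fderiv, hmf]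
    exact (hιd (G t)).comp ht
  -- a continuous linear left inverse
  set L : ℂ →L[ℝ] EuclideanSpace ℝ (Fin N) := fderiv ℝ F t with hL
  obtain ⟨P, hP⟩ := (L : ℂ →ₗ[ℝ] EuclideanSpace ℝ (Fin N)).exists_leftInverse_of_injective
    (LinearMap.ker_eq_bot.2 hLinj)
  set Pc : EuclideanSpace ℝ (Fin N) →L[ℝ] ℂ := LinearMap.toContinuousLinearMap P with hPc
  have hPL : ∀ v : ℂ, Pc (L v) = v := fun v => by
    have := LinearMap.congr_fun hP v
    change P (L v) = v
    simpa using this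
  -- `H := Pc ∘ F` has derivative the identity at `t`
  set H : ℂ → ℂ := fun z => Pc (F z) with hH
  have hHd : HasStrictFDerivAt H ((ContinuousLinearEquiv.refl ℝ ℂ : ℂ ≃L[ℝ] ℂ) : ℂ →L[ℝ] ℂ) t := by
    have h1 : HasStrictFDerivAt F L t := (hFd.contDiffAt.hasStrictFDerivAt (by simp))
    have h2 : HasStrictFDerivAt H (Pc.comp L) t := Pc.hasStrictFDerivAt.comp t h1
    have e : Pc.comp L = ((ContinuousLinearEquiv.refl ℝ ℂ : ℂ ≃L[ℝ] ℂ) : ℂ →L[ℝ] ℂ) := by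
      ext1 v
      simp [hPL]
    rwa [e] at h2
  -- inverse function theorem: `H` is injective on a neighbourhood of `t`
  set Φ := hHd.toOpenPartialHomeomorph H with hΦ
  have hsrc : Φ.source ∈ 𝓝 t :=
    Φ.open_source.mem_nhds hHd.mem_toOpenPartialHomeomorph_source
  have hcoe : (Φ : ℂ → ℂ) = H := hHd.toOpenPartialHomeomorph_coe
  obtain ⟨ρ, hρ, hball⟩ := Metric.mem_nhds_iff.1 hsrc
  refine ⟨ρ, hρ, fun x hx y hy hxy => ?_⟩
  have hHxy : H x = H y := by simp only [hH, hF, hxy]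
  have hΦxy : Φ x = Φ y := by rw [hcoe]; exact hHxy
  exact Φ.injOn (hball hx) (hball hy) hΦxy

/-! ### Two metric trivialities -/

/-- `ball c (r - ‖c‖) ⊆ ball 0 r`. [folklore] -/
theorem ball_sub_norm_subset_ball (c : ℂ) (r : ℝ) :
    Metric.ball c (r - ‖c‖) ⊆ Metric.ball (0 : ℂ) r := by
  intro x hx
  rw [Metric.mem_ball, dist_eq_norm] at hx
  rw [mem_ball_zero_iff]
  calc ‖x‖ = ‖(x - c) + c‖ := by rw [sub_add_cancel]
    _ ≤ ‖x - c‖ + ‖c‖ := norm_add_le _ _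
    _ < (r - ‖c‖) + ‖c‖ := by linarith
    _ = r := by ring

/-- The real point `(r₀ + r₁)/2` of `ℂ` has norm `(r₀ + r₁)/2` when `0 < r₀ < r₁`. [folklore] -/
theorem norm_midpoint_cast {r₀ r₁ : ℝ} (hr₀ : 0 < r₀) (hr₁ : r₀ < r₁) :
    ‖(((r₀ + r₁) / 2 : ℝ) : ℂ)‖ = (r₀ + r₁) / 2 := by
  rw [Complex.norm_real, Real.norm_eq_abs, abs_of_pos (by linarith)]

/-! ### A disc minus finitely many points is path connected -/

/-- An open disc of `ℂ` minus a finite set is path connected (the disc is the homeomorphic image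
of the plane under `OpenPartialHomeomorph.univBall`, and the complement of a countable subset of
the plane is path connected). [folklore] -/
theorem isPathConnected_ball_diff_finite {r : ℝ} (hr : 0 < r) {F : Set ℂ} (hF : F.Finite) :
    IsPathConnected (Metric.ball (0 : ℂ) r \ F) := by
  set e := OpenPartialHomeomorph.univBall (0 : ℂ) r with he
  have hsrc : e.source = univ := OpenPartialHomeomorph.univBall_source 0 r
  have htgt : e.target = Metric.ball 0 r := OpenPartialHomeomorph.univBall_target 0 hr
  set T : Set ℂ := e ⁻¹' F with hT
  have hTfin : T.Finite := hF.preimage (e.injOn.mono (by rw [hsrc]; exact subset_univ _))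
  have hrank : 1 < Module.rank ℝ ℂ := by
    rw [← Module.finrank_eq_rank, Complex.finrank_real_complex]; norm_num
  have hpc : IsPathConnected Tᶜ := hTfin.countable.isPathConnected_compl_of_one_lt_rank hrank
  have himg : e '' Tᶜ = Metric.ball 0 r \ F := by
    ext t
    constructor
    · rintro ⟨z, hz, rfl⟩
      exact ⟨by rw [← htgt]; exact e.map_source (by rw [hsrc]; trivial), hz⟩
    · rintro ⟨ht, htF⟩
      have ht' : t ∈ e.target := by rw [htgt]; exact ht
      refine ⟨e.symm t, ?_, e.right_inv ht'⟩
      show e (e.symm t) ∉ F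
      rw [e.right_inv ht']
      exact htF
  rw [← himg]
  exact hpc.image' (e.continuousOn.mono (by rw [hsrc]; exact subset_univ _))

end LimitEmbedded

open LimitEmbedded

/-! ### The reduction -/

/-- **McDuff's limit theorem from the local facts.** GIVEN unique continuation from open sets
(McDuff 1991 Lemma 2.3), the local branch dichotomy (Wendl, Lectures, Thm 2.88), the persistence
of isolated intersections (McDuff Thm 1.1, (5.1)) and the absence of cusps in limits of embedded
curves (McDuff Thm 1.4, Cor. 4.4) — the named facts of
`Literature/Geometry/Symplectic/JHolomorphicLocalIntersections.lean` — the named fact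
`jHolomorphicLimitOfEmbedded_isEmbedded` (McDuff 1991 §4: a locally uniform limit `G` of
embedded `J`-planes which embeds a separating collar `r₀ < |ξ| < r₁` is embedded on `|ξ| < r₁`)
holds; the intersection dichotomy (McDuff Lemma 2.7) enters through the theorem
`jHolomorphic_intersectionDichotomy_holds`. Proof ((5.5) of the paper, made elementary): every
pair of distinct points of the disc with the same image lies in the closed inner disc (collar
injectivity + separation); the non-injectivity locus `N ⊆ closedBall 0 r₀` is open — at a
regular point of `N` the two branches either meet in isolation (then the approximating embedded
curves would meet: persistence, contradiction) or have the same image germ (then all nearby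
points have partners), and a critical point is of branched type (an injective critical germ is
excluded by the no-cusp fact), so a punctured neighbourhood lies in `N` — and its closure is open
too (a limit of points of `N` outside `N` is not locally injective, hence critical, hence
branched), so `closure N` is a clopen subset of the connected disc inside the inner closed disc:
empty. Injectivity follows, and a critical point would produce points of `N`.
[cite: McDuff1991LocalBehaviour, Lemma 4.3, Lemma 4.2(i), Thm 1.1, Thm 1.4, (5.5)] -/
theorem jHolomorphicLimitOfEmbedded_isEmbedded_of_local
    (hUC : jHolomorphic_uniqueContinuation_const)
    (hLoc : jHolomorphic_localBranchDichotomy)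
    (hPos : jHolomorphic_isolatedIntersection_persists)
    (hCusp : jHolomorphic_immersed_of_limitEmbedded_punctured) :
    jHolomorphicLimitOfEmbedded_isEmbedded := by
  have hInt : jHolomorphic_intersectionDichotomy := jHolomorphic_intersectionDichotomy_holds
  intro V _ _ _ _ _ J hJ2 hJs N ι hιe hιs hιd u G r₀ r₁ hr₀ hr₁ hus huJ
    huinj huimm hGs hGJ hconv hinjA himmA hsep
  -- (1) partners live in the inner closed disc
  have O1 : ∀ s t : ℂ, ‖s‖ < r₁ → ‖t‖ < r₁ → s ≠ t → G s = G t → ‖t‖ ≤ r₀ ∧ ‖s‖ ≤ r₀ := by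
    have key : ∀ a b : ℂ, ‖a‖ < r₁ → ‖b‖ < r₁ → a ≠ b → G a = G b → ‖b‖ ≤ r₀ := by
      intro a b ha hb hab hGab
      by_contra hb'
      rw [not_le] at hb'
      by_cases ha' : r₀ < ‖a‖
      · exact hab (hinjA ⟨ha', ha⟩ ⟨hb', hb⟩ hGab)
      · rw [not_lt] at ha'
        exact hsep a b ha' hb' hb hGab
    intro s t hs ht hne hG
    exact ⟨key s t hs ht hne hG, key t s ht hs hne.symm hG.symm⟩
  -- a point of the collar
  set ξ₀ : ℂ := (((r₀ + r₁) / 2 : ℝ) : ℂ) with hξ₀def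
  have hξ₀n : ‖ξ₀‖ = (r₀ + r₁) / 2 := norm_midpoint_cast hr₀ hr₁
  have hξ₀A : r₀ < ‖ξ₀‖ ∧ ‖ξ₀‖ < r₁ := by rw [hξ₀n]; constructor <;> linarith
  -- (2) `G` is nowhere locally constant
  have NC : ∀ t : ℂ, ∃ᶠ z in 𝓝 t, G z ≠ G t := by
    intro t
    by_contra h
    have hev : ∀ᶠ z in 𝓝 t, G z = G t := by
      simpa only [Filter.not_frequently, not_not] using h
    have hconst := hUC V J hJ2 hJs G hGs hGJ t hev
    have hGeq : G = fun _ => G t := funext hconst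
    have hzero : mfderiv 𝓘(ℝ, ℂ) (𝓡 4) G ξ₀ = 0 := by rw [hGeq]; exact mfderiv_const
    have hinj := himmA ξ₀ hξ₀A.1 hξ₀A.2
    rw [hzero] at hinj
    have h10 : (1 : ℂ) = (0 : ℂ) := @hinj (1 : ℂ) (0 : ℂ) (by simp)
    exact one_ne_zero h10
  have NCs : ∀ c : ℂ, ∃ᶠ z in 𝓝 (0 : ℂ), G (z + c) ≠ G (0 + c) := by
    intro c
    have h := NC c
    rw [← map_add_right_nhds_zero c, Filter.frequently_map] at h
    simpa only [zero_add] using h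
  -- (3) shifted data
  have hGc : ∀ c : ℂ, ContMDiff 𝓘(ℝ, ℂ) (𝓡 4) ∞ (fun z : ℂ => G (z + c)) := fun c =>
    contMDiff_comp_add_const hGs c
  have hGJc : ∀ c : ℂ, IsJHolomorphic (𝓡 4) J (fun z : ℂ => G (z + c)) := fun c =>
    isJHolomorphic_comp_add_const hGs hGJ c
  have huc : ∀ (n : ℕ) (c : ℂ), ContMDiff 𝓘(ℝ, ℂ) (𝓡 4) ∞ (fun z : ℂ => u n (z + c)) :=
    fun n c => contMDiff_comp_add_const (hus n) c
  have huJc : ∀ (n : ℕ) (c : ℂ), IsJHolomorphic (𝓡 4) J (fun z : ℂ => u n (z + c)) :=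
    fun n c => isJHolomorphic_comp_add_const (hus n) (huJ n) c
  have huinjc : ∀ (n : ℕ) (c : ℂ), Function.Injective (fun z : ℂ => u n (z + c)) :=
    fun n c a b h => add_right_cancel (huinj n h)
  have huimmc : ∀ (n : ℕ) (c z : ℂ),
      Function.Injective (mfderiv 𝓘(ℝ, ℂ) (𝓡 4) (fun z : ℂ => u n (z + c)) z) := by
    intro n c z
    rw [mfderiv_comp_add_const (hus n)]
    exact huimm n (z + c)
  have hconvc : ∀ (c : ℂ) (ρ : ℝ), TendstoUniformlyOn (fun n z => ι (u n (z + c)))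
      (fun z => ι (G (z + c))) atTop (Metric.closedBall (0 : ℂ) ρ) :=
    fun c ρ => tendstoUniformlyOn_comp_add_const hconv c ρ
  -- (4) regular points are locally injective
  have LI : ∀ t : ℂ, Function.Injective (mfderiv 𝓘(ℝ, ℂ) (𝓡 4) G t) →
      ∃ ρ : ℝ, 0 < ρ ∧ Set.InjOn G (Metric.ball t ρ) :=
    fun t ht => exists_injOn_ball_of_mfderiv_injective hιs hιd hGs ht
  -- (5) a critical point is of branched type (an injective critical germ would be a cusp)
  have hMC : ∀ c : ℂ, ¬ Function.Injective (mfderiv 𝓘(ℝ, ℂ) (𝓡 4) G c) →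
      ∀ ρ : ℝ, 0 < ρ → ∃ ρ' : ℝ, 0 < ρ' ∧ ∀ t ∈ Metric.ball c ρ', t ≠ c →
        ∃ s ∈ Metric.ball c ρ, s ≠ t ∧ G s = G t := by
    intro c hc
    rcases hLoc V J hJ2 hJs G hGs hGJ c (NC c) with ⟨ρ₁, hρ₁, hinj1, himm1⟩ | h2
    · exfalso
      apply hc
      have hinj' : Set.InjOn (fun z : ℂ => G (z + c)) (Metric.ball (0 : ℂ) ρ₁) := by
        intro a ha b hb hab
        have ha' : a + c ∈ Metric.ball c ρ₁ := by
          simpa [Metric.mem_ball, dist_eq_norm] using ha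
        have hb' : b + c ∈ Metric.ball c ρ₁ := by
          simpa [Metric.mem_ball, dist_eq_norm] using hb
        exact add_right_cancel (hinj1 ha' hb' hab)
      have himm' : ∀ z ∈ Metric.ball (0 : ℂ) ρ₁, z ≠ 0 →
          Function.Injective (mfderiv 𝓘(ℝ, ℂ) (𝓡 4) (fun z : ℂ => G (z + c)) z) := by
        intro z hz hz0
        rw [mfderiv_comp_add_const hGs]
        refine himm1 (z + c) ?_ ?_
        · simpa [Metric.mem_ball, dist_eq_norm] using hz
        · simpa using hz0
      have key := hCusp V J hJ2 hJs N ι hιe hιs hιd (fun z : ℂ => G (z + c)) (hGc c) (hGJc c)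
        ρ₁ hρ₁ hinj' himm' (fun n z => u n (z + c)) (fun n => huc n c) (fun n => huJc n c)
        (fun n => huinjc n c) (fun n => huimmc n c) (hconvc c ρ₁)
      rwa [mfderiv_comp_add_const hGs, zero_add] at key
    · exact h2
  -- (6) the non-injectivity locus
  set B : Set ℂ := Metric.ball (0 : ℂ) r₁ with hBdef
  set Nn : Set ℂ := {t | t ∈ B ∧ ∃ s ∈ B, s ≠ t ∧ G s = G t} with hNdef
  have hNB : Nn ⊆ B := fun t ht => ht.1
  have hNr₀ : Nn ⊆ Metric.closedBall (0 : ℂ) r₀ := by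
    rintro t ⟨htB, s, hsB, hst, hG⟩
    exact mem_closedBall_zero_iff.2
      (O1 s t (mem_ball_zero_iff.1 hsB) (mem_ball_zero_iff.1 htB) hst hG).1
  have hclNr₀ : closure Nn ⊆ Metric.closedBall (0 : ℂ) r₀ :=
    closure_minimal hNr₀ Metric.isClosed_closedBall
  have hr₀B : Metric.closedBall (0 : ℂ) r₀ ⊆ B := Metric.closedBall_subset_ball hr₁
  have hclNB : closure Nn ⊆ B := hclNr₀.trans hr₀B
  -- a punctured neighbourhood of a critical point of `B` lies in `Nn`
  have hMCN : ∀ c ∈ B, ¬ Function.Injective (mfderiv 𝓘(ℝ, ℂ) (𝓡 4) G c) →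
      ∃ ρ' : ℝ, 0 < ρ' ∧ ∀ t ∈ Metric.ball c ρ', t ≠ c → t ∈ Nn := by
    intro c hcB hc
    have hρ : 0 < r₁ - ‖c‖ := sub_pos.2 (mem_ball_zero_iff.1 hcB)
    obtain ⟨ρ', hρ', h⟩ := hMC c hc (r₁ - ‖c‖) hρ
    refine ⟨min ρ' (r₁ - ‖c‖), lt_min hρ' hρ, fun t ht htc => ?_⟩
    have ht1 : t ∈ Metric.ball c ρ' := Metric.ball_subset_ball (min_le_left _ _) ht
    have htB : t ∈ B :=
      ball_sub_norm_subset_ball c r₁ (Metric.ball_subset_ball (min_le_right _ _) ht)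
    obtain ⟨s, hs, hst, hG⟩ := h t ht1 htc
    exact ⟨htB, s, ball_sub_norm_subset_ball c r₁ hs, hst, hG⟩
  -- `Nn` is open
  have hNopen : ∀ t ∈ Nn, ∃ ρ : ℝ, 0 < ρ ∧ Metric.ball t ρ ⊆ Nn := by
    rintro t ⟨htB, s, hsB, hst, hGst⟩
    have hd : 0 < ‖s - t‖ / 2 := by
      have : 0 < ‖s - t‖ := norm_pos_iff.2 (sub_ne_zero.2 hst)
      linarith
    by_cases hreg : Function.Injective (mfderiv 𝓘(ℝ, ℂ) (𝓡 4) G t)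
    · have h0 : (fun z : ℂ => G (z + s)) 0 = (fun z : ℂ => G (z + t)) 0 := by
        simp only [zero_add, hGst]
      have hreg' : Function.Injective (mfderiv 𝓘(ℝ, ℂ) (𝓡 4) (fun z : ℂ => G (z + t)) 0) := by
        rw [mfderiv_comp_add_const hGs, zero_add]; exact hreg
      rcases hInt V J hJ2 hJs (fun z : ℂ => G (z + s)) (fun z : ℂ => G (z + t)) (hGc s)
        (hGJc s) (hGc t) (hGJc t) h0 hreg' (NCs s) with ⟨ρ₃, hρ₃, hiso⟩ | hco
      · -- isolated: the embedded approximants would meet (positivity / persistence)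
        exfalso
        set ρ₄ : ℝ := min ρ₃ (‖s - t‖ / 2) with hρ₄def
        have hρ₄ : 0 < ρ₄ := lt_min hρ₃ hd
        have hiso' : ∀ a ∈ Metric.ball (0 : ℂ) ρ₄, ∀ b ∈ Metric.ball (0 : ℂ) ρ₄,
            G (a + s) = G (b + t) → a = 0 ∧ b = 0 := fun a ha b hb h =>
          hiso a (Metric.ball_subset_ball (min_le_left _ _) ha) b
            (Metric.ball_subset_ball (min_le_left _ _) hb) h
        have hev := hPos V J hJ2 hJs N ι hιe hιs hιd (fun z : ℂ => G (z + s))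
          (fun z : ℂ => G (z + t)) (hGc s) (hGJc s) (hGc t) (hGJc t) h0 hreg' ρ₄ hρ₄ hiso'
          (fun n z => u n (z + s)) (fun n z => u n (z + t)) (fun n => huc n s)
          (fun n => huJc n s) (fun n => huc n t) (fun n => huJc n t) (hconvc s ρ₄) (hconvc t ρ₄)
        obtain ⟨n, a, ha, b, hb, hab⟩ := hev.exists
        have heq : a + s = b + t := huinj n hab
        have h1 : s - t = b - a := by linear_combination heq
        have ha' : ‖a‖ < ‖s - t‖ / 2 :=
          lt_of_lt_of_le (mem_ball_zero_iff.1 ha) (min_le_right _ _)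
        have hb' : ‖b‖ < ‖s - t‖ / 2 :=
          lt_of_lt_of_le (mem_ball_zero_iff.1 hb) (min_le_right _ _)
        have : ‖s - t‖ < ‖s - t‖ :=
          calc ‖s - t‖ = ‖b - a‖ := by rw [h1]
            _ ≤ ‖b‖ + ‖a‖ := norm_sub_le b a
            _ < ‖s - t‖ / 2 + ‖s - t‖ / 2 := add_lt_add hb' ha'
            _ = ‖s - t‖ := by ring
        exact lt_irrefl _ this
      · -- same image germ: every nearby point has a partner near `s`
        have hρ : 0 < min (‖s - t‖ / 2) (r₁ - ‖s‖) :=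
          lt_min hd (sub_pos.2 (mem_ball_zero_iff.1 hsB))
        obtain ⟨ρ', hρ', -, hsub⟩ := hco _ hρ
        have hρ'' : 0 < min (min ρ' (r₁ - ‖t‖)) (‖s - t‖ / 2) :=
          lt_min (lt_min hρ' (sub_pos.2 (mem_ball_zero_iff.1 htB))) hd
        refine ⟨_, hρ'', fun t' ht' => ?_⟩
        have ht'1 : ‖t' - t‖ < ρ' := by
          have := Metric.ball_subset_ball ((min_le_left _ _).trans (min_le_left _ _)) ht'
          rwa [Metric.mem_ball, dist_eq_norm] at this
        have ht'2 : ‖t' - t‖ < ‖s - t‖ / 2 := by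
          have := Metric.ball_subset_ball (min_le_right _ _) ht'
          rwa [Metric.mem_ball, dist_eq_norm] at this
        have ht'B : t' ∈ B :=
          ball_sub_norm_subset_ball t r₁
            (Metric.ball_subset_ball ((min_le_left _ _).trans (min_le_right _ _)) ht')
        have hmem : G t' ∈ (fun z : ℂ => G (z + t)) '' Metric.ball (0 : ℂ) ρ' :=
          ⟨t' - t, mem_ball_zero_iff.2 ht'1, by simp only [sub_add_cancel]⟩
        obtain ⟨σ, hσ, hGσ⟩ := hsub hmem
        have hσ1 : ‖σ‖ < ‖s - t‖ / 2 :=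
          lt_of_lt_of_le (mem_ball_zero_iff.1 hσ) (min_le_left _ _)
        have hσ2 : ‖σ‖ < r₁ - ‖s‖ :=
          lt_of_lt_of_le (mem_ball_zero_iff.1 hσ) (min_le_right _ _)
        refine ⟨ht'B, σ + s, ?_, ?_, hGσ⟩
        · rw [mem_ball_zero_iff]
          calc ‖σ + s‖ ≤ ‖σ‖ + ‖s‖ := norm_add_le _ _
            _ < (r₁ - ‖s‖) + ‖s‖ := by linarith
            _ = r₁ := by ring
        · intro h
          have h2 : s - t = (t' - t) - σ := by rw [← h]; ring
          have : ‖s - t‖ < ‖s - t‖ :=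
            calc ‖s - t‖ = ‖(t' - t) - σ‖ := by rw [h2]
              _ ≤ ‖t' - t‖ + ‖σ‖ := norm_sub_le _ _
              _ < ‖s - t‖ / 2 + ‖s - t‖ / 2 := add_lt_add ht'2 hσ1
              _ = ‖s - t‖ := by ring
          exact lt_irrefl _ this
    · obtain ⟨ρ', hρ', hp⟩ := hMCN t htB hreg
      refine ⟨ρ', hρ', fun t' ht' => ?_⟩
      by_cases h : t' = t
      · rw [h]; exact ⟨htB, s, hsB, hst, hGst⟩
      · exact hp t' ht' h
  -- `closure Nn` is open
  have hclopen : IsOpen (closure Nn) := by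
    rw [Metric.isOpen_iff]
    intro t htcl
    by_cases htN : t ∈ Nn
    · obtain ⟨ρ, hρ, hsub⟩ := hNopen t htN
      exact ⟨ρ, hρ, hsub.trans subset_closure⟩
    · have htB : t ∈ B := hclNB htcl
      have hcrit : ¬ Function.Injective (mfderiv 𝓘(ℝ, ℂ) (𝓡 4) G t) := by
        intro hreg
        obtain ⟨ρ, hρ, hinj⟩ := LI t hreg
        obtain ⟨tk, htkN, htk⟩ := mem_closure_iff_seq_limit.1 htcl
        choose sk hsk using fun k => (htkN k).2
        have hskr : ∀ k, sk k ∈ Metric.closedBall (0 : ℂ) r₀ := fun k =>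
          mem_closedBall_zero_iff.2 (O1 (sk k) (tk k) (mem_ball_zero_iff.1 (hsk k).1)
            (mem_ball_zero_iff.1 (htkN k).1) (hsk k).2.1 (hsk k).2.2).2
        obtain ⟨sstar, hsstar, φ, hφ, hlim⟩ :=
          (isCompact_closedBall (0 : ℂ) r₀).tendsto_subseq hskr
        have hcont : Continuous G := hGs.continuous
        have hGlim1 : Tendsto (fun k => G (sk (φ k))) atTop (𝓝 (G sstar)) :=
          (hcont.tendsto _).comp hlim
        have htk' : Tendsto (fun k => tk (φ k)) atTop (𝓝 t) := htk.comp hφ.tendsto_atTop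
        have hGlim2 : Tendsto (fun k => G (tk (φ k))) atTop (𝓝 (G t)) :=
          (hcont.tendsto _).comp htk'
        have heqfun : (fun k => G (sk (φ k))) = fun k => G (tk (φ k)) :=
          funext fun k => (hsk (φ k)).2.2
        rw [heqfun] at hGlim1
        have hGeq : G sstar = G t := tendsto_nhds_unique hGlim1 hGlim2
        by_cases hst : sstar = t
        · have h1 : ∀ᶠ k in atTop, sk (φ k) ∈ Metric.ball t ρ := by
            rw [← hst]; exact hlim (Metric.ball_mem_nhds _ hρ)
          have h2 : ∀ᶠ k in atTop, tk (φ k) ∈ Metric.ball t ρ :=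
            htk' (Metric.ball_mem_nhds _ hρ)
          obtain ⟨k, hk1, hk2⟩ := (h1.and h2).exists
          exact (hsk (φ k)).2.1 (hinj hk1 hk2 (hsk (φ k)).2.2)
        · exact htN ⟨htB, sstar, hr₀B hsstar, hst, hGeq⟩
      obtain ⟨ρ', hρ', hp⟩ := hMCN t htB hcrit
      refine ⟨ρ', hρ', fun t' ht' => ?_⟩
      by_cases h : t' = t
      · rw [h]; exact htcl
      · exact subset_closure (hp t' ht' h)
  -- clopen in the connected disc, inside the inner closed disc: empty
  have hNempty : ∀ t, t ∉ Nn := by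
    have hpre : IsPreconnected B := (convex_ball (0 : ℂ) r₁).isPreconnected
    rcases hpre.subset_or_subset hclopen isClosed_closure.isOpen_compl disjoint_compl_right
        (by rw [Set.union_compl_self]; exact subset_univ _) with h | h
    · exfalso
      have hξ₀B : ξ₀ ∈ B := mem_ball_zero_iff.2 hξ₀A.2
      have := mem_closedBall_zero_iff.1 (hclNr₀ (h hξ₀B))
      linarith [hξ₀A.1]
    · intro t ht
      exact h (hNB ht) (subset_closure ht)
  -- conclusion
  refine ⟨?_, ?_⟩
  · intro s hs t ht hG
    by_contra hne
    exact hNempty t ⟨ht, s, hs, hne, hG⟩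
  · intro ξ hξ
    by_contra hni
    obtain ⟨ρ', hρ', hp⟩ := hMCN ξ hξ hni
    have hmem : ξ + ((ρ' / 2 : ℝ) : ℂ) ∈ Metric.ball ξ ρ' := by
      rw [Metric.mem_ball, dist_eq_norm, add_sub_cancel_left, Complex.norm_real, Real.norm_eq_abs,
        abs_of_pos (by linarith)]
      linarith
    have hne : ξ + ((ρ' / 2 : ℝ) : ℂ) ≠ ξ := by
      intro h
      have : ((ρ' / 2 : ℝ) : ℂ) = 0 := by simpa using h
      have : (ρ' / 2 : ℝ) = 0 := by exact_mod_cast this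
      linarith
    exact hNempty _ (hp _ hmem hne)

/-! ### The reduction without the local branch dichotomy -/

/-- **McDuff's limit theorem from positivity of intersections and the no-cusp theorem alone.**
GIVEN the persistence of isolated intersections (McDuff 1991 Thm 1.1, (5.1)(i)–(ii)) and the
absence of cusps in limits of embedded curves (McDuff Thm 1.4, Cor. 4.4) — two of the named facts
of `Literature/Geometry/Symplectic/JHolomorphicLocalIntersections.lean` — the named fact
`jHolomorphicLimitOfEmbedded_isEmbedded` holds. Unique continuation (McDuff Lemma 2.3), the
intersection dichotomy (Lemma 2.7) and the isolatedness of critical points (Lemma 2.7, first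
statement) enter as THEOREMS (`jHolomorphic_uniqueContinuation_const_holds`,
`jHolomorphic_intersectionDichotomy_holds`, `IsJHolomorphic.eventually_injective_mfderiv`); the
local branch dichotomy is not needed. Proof ((5.5) of the paper, made elementary): partners of
distinct points of the disc `B` with equal images lie in the inner closed disc; the critical
points of `G` in `B` form a finite set `Z`; on the connected set `B ∖ Z` the locus `N₂` of regular
points with a distinct partner in `B` is open — at `t ∈ N₂` with partner `s` the branches of `G`
at `t` (regular) and `s` either meet in isolation, and then the embedded approximants
`uₙ(· + s)`, `uₙ(· + t)` would meet (persistence), or have the same image germ, and then every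
point near `t` has a partner near `s` — and relatively closed (a limit `t ∈ B ∖ Z` of points of
`N₂` has a limit partner, distinct from `t` because a regular point is locally injective), and it
misses the collar point `(r₀ + r₁)/2`: so `N₂ = ∅`. A critical point `c ∈ B` would then have no
regular partner, whence `G` is injective on a disc about `c` and immersive on the punctured disc,
and the no-cusp fact applied to `G(· + c)` and the `uₙ(· + c)` makes `c` regular: `Z = ∅`, and
injectivity of `G` on `B` follows from `N₂ = ∅`.
[cite: McDuff1991LocalBehaviour, Thm 1.1, Thm 1.4, Cor. 4.4, Lemma 2.7, (5.5)] -/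
theorem jHolomorphicLimitOfEmbedded_isEmbedded_of_persist_of_noCusp
    (hPos : jHolomorphic_isolatedIntersection_persists)
    (hCusp : jHolomorphic_immersed_of_limitEmbedded_punctured) :
    jHolomorphicLimitOfEmbedded_isEmbedded := by
  have hUC : jHolomorphic_uniqueContinuation_const := jHolomorphic_uniqueContinuation_const_holds
  have hInt : jHolomorphic_intersectionDichotomy := jHolomorphic_intersectionDichotomy_holds
  intro V _ _ _ _ _ J hJ2 hJs N ι hιe hιs hιd u G r₀ r₁ hr₀ hr₁ hus huJ
    huinj huimm hGs hGJ hconv hinjA himmA hsep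
  -- (1) partners live in the inner closed disc
  have O1 : ∀ s t : ℂ, ‖s‖ < r₁ → ‖t‖ < r₁ → s ≠ t → G s = G t → ‖t‖ ≤ r₀ ∧ ‖s‖ ≤ r₀ := by
    have key : ∀ a b : ℂ, ‖a‖ < r₁ → ‖b‖ < r₁ → a ≠ b → G a = G b → ‖b‖ ≤ r₀ := by
      intro a b ha hb hab hGab
      by_contra hb'
      rw [not_le] at hb'
      by_cases ha' : r₀ < ‖a‖
      · exact hab (hinjA ⟨ha', ha⟩ ⟨hb', hb⟩ hGab)
      · rw [not_lt] at ha'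
        exact hsep a b ha' hb' hb hGab
    intro s t hs ht hne hG
    exact ⟨key s t hs ht hne hG, key t s ht hs hne.symm hG.symm⟩
  -- a point of the collar
  set ξ₀ : ℂ := (((r₀ + r₁) / 2 : ℝ) : ℂ) with hξ₀def
  have hξ₀n : ‖ξ₀‖ = (r₀ + r₁) / 2 := norm_midpoint_cast hr₀ hr₁
  have hξ₀A : r₀ < ‖ξ₀‖ ∧ ‖ξ₀‖ < r₁ := by rw [hξ₀n]; constructor <;> linarith
  -- (2) `G` is nowhere locally constant
  have NC : ∀ t : ℂ, ∃ᶠ z in 𝓝 t, G z ≠ G t := by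
    intro t
    by_contra h
    have hev : ∀ᶠ z in 𝓝 t, G z = G t := by
      simpa only [Filter.not_frequently, not_not] using h
    have hconst := hUC V J hJ2 hJs G hGs hGJ t hev
    have hGeq : G = fun _ => G t := funext hconst
    have hzero : mfderiv 𝓘(ℝ, ℂ) (𝓡 4) G ξ₀ = 0 := by rw [hGeq]; exact mfderiv_const
    have hinj := himmA ξ₀ hξ₀A.1 hξ₀A.2
    rw [hzero] at hinj
    have h10 : (1 : ℂ) = (0 : ℂ) := @hinj (1 : ℂ) (0 : ℂ) (by simp)
    exact one_ne_zero h10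
  have NCs : ∀ c : ℂ, ∃ᶠ z in 𝓝 (0 : ℂ), G (z + c) ≠ G (0 + c) := by
    intro c
    have h := NC c
    rw [← map_add_right_nhds_zero c, Filter.frequently_map] at h
    simpa only [zero_add] using h
  -- (3) shifted data
  have hGc : ∀ c : ℂ, ContMDiff 𝓘(ℝ, ℂ) (𝓡 4) ∞ (fun z : ℂ => G (z + c)) := fun c =>
    contMDiff_comp_add_const hGs c
  have hGJc : ∀ c : ℂ, IsJHolomorphic (𝓡 4) J (fun z : ℂ => G (z + c)) := fun c =>
    isJHolomorphic_comp_add_const hGs hGJ c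
  have huc : ∀ (n : ℕ) (c : ℂ), ContMDiff 𝓘(ℝ, ℂ) (𝓡 4) ∞ (fun z : ℂ => u n (z + c)) :=
    fun n c => contMDiff_comp_add_const (hus n) c
  have huJc : ∀ (n : ℕ) (c : ℂ), IsJHolomorphic (𝓡 4) J (fun z : ℂ => u n (z + c)) :=
    fun n c => isJHolomorphic_comp_add_const (hus n) (huJ n) c
  have huinjc : ∀ (n : ℕ) (c : ℂ), Function.Injective (fun z : ℂ => u n (z + c)) :=
    fun n c a b h => add_right_cancel (huinj n h)
  have huimmc : ∀ (n : ℕ) (c z : ℂ),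
      Function.Injective (mfderiv 𝓘(ℝ, ℂ) (𝓡 4) (fun z : ℂ => u n (z + c)) z) := by
    intro n c z
    rw [mfderiv_comp_add_const (hus n)]
    exact huimm n (z + c)
  have hconvc : ∀ (c : ℂ) (ρ : ℝ), TendstoUniformlyOn (fun n z => ι (u n (z + c)))
      (fun z => ι (G (z + c))) atTop (Metric.closedBall (0 : ℂ) ρ) :=
    fun c ρ => tendstoUniformlyOn_comp_add_const hconv c ρ
  -- (4) regular points are locally injective
  have LI : ∀ t : ℂ, Function.Injective (mfderiv 𝓘(ℝ, ℂ) (𝓡 4) G t) →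
      ∃ ρ : ℝ, 0 < ρ ∧ Set.InjOn G (Metric.ball t ρ) :=
    fun t ht => exists_injOn_ball_of_mfderiv_injective hιs hιd hGs ht
  -- (5) critical points are isolated (McDuff Lemma 2.7); regular points form an open set
  have CI : ∀ c : ℂ, ∀ᶠ z in 𝓝[≠] c, Function.Injective (mfderiv 𝓘(ℝ, ℂ) (𝓡 4) G z) :=
    fun c => IsJHolomorphic.eventually_injective_mfderiv hJ2 hJs hGs hGJ (NC c)
  have CIball : ∀ c : ℂ, ∃ ρ : ℝ, 0 < ρ ∧ ∀ z ∈ Metric.ball c ρ, z ≠ c →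
      Function.Injective (mfderiv 𝓘(ℝ, ℂ) (𝓡 4) G z) := by
    intro c
    obtain ⟨ρ, hρ, hb⟩ := Metric.eventually_nhds_iff_ball.1 (eventually_nhdsWithin_iff.1 (CI c))
    exact ⟨ρ, hρ, fun z hz hzc => hb z hz hzc⟩
  have RegOpen : ∀ t : ℂ, Function.Injective (mfderiv 𝓘(ℝ, ℂ) (𝓡 4) G t) →
      ∃ ρ : ℝ, 0 < ρ ∧ ∀ z ∈ Metric.ball t ρ,
        Function.Injective (mfderiv 𝓘(ℝ, ℂ) (𝓡 4) G z) := by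
    intro t ht
    obtain ⟨ρ, hρ, hb⟩ := CIball t
    refine ⟨ρ, hρ, fun z hz => ?_⟩
    by_cases h : z = t
    · rw [h]; exact ht
    · exact hb z hz h
  -- (6) the disc, its regular part, and the locus `N₂` of regular points with a partner
  set B : Set ℂ := Metric.ball (0 : ℂ) r₁ with hBdef
  have hr₀B : Metric.closedBall (0 : ℂ) r₀ ⊆ B := Metric.closedBall_subset_ball hr₁
  set N₂ : Set ℂ := {t | t ∈ B ∧ Function.Injective (mfderiv 𝓘(ℝ, ℂ) (𝓡 4) G t) ∧
    ∃ s ∈ B, s ≠ t ∧ G s = G t} with hN₂def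
  -- `N₂` is open
  have hNopen : ∀ t ∈ N₂, ∃ ρ : ℝ, 0 < ρ ∧ Metric.ball t ρ ⊆ N₂ := by
    rintro t ⟨htB, hreg, s, hsB, hst, hGst⟩
    have hd : 0 < ‖s - t‖ / 2 := by
      have : 0 < ‖s - t‖ := norm_pos_iff.2 (sub_ne_zero.2 hst)
      linarith
    obtain ⟨ρr, hρr, hρreg⟩ := RegOpen t hreg
    have h0 : (fun z : ℂ => G (z + s)) 0 = (fun z : ℂ => G (z + t)) 0 := by
      simp only [zero_add, hGst]
    have hreg' : Function.Injective (mfderiv 𝓘(ℝ, ℂ) (𝓡 4) (fun z : ℂ => G (z + t)) 0) := by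
      rw [mfderiv_comp_add_const hGs, zero_add]; exact hreg
    rcases hInt V J hJ2 hJs (fun z : ℂ => G (z + s)) (fun z : ℂ => G (z + t)) (hGc s)
      (hGJc s) (hGc t) (hGJc t) h0 hreg' (NCs s) with ⟨ρ₃, hρ₃, hiso⟩ | hco
    · -- isolated: the embedded approximants would meet (positivity / persistence)
      exfalso
      set ρ₄ : ℝ := min ρ₃ (‖s - t‖ / 2) with hρ₄def
      have hρ₄ : 0 < ρ₄ := lt_min hρ₃ hd
      have hiso' : ∀ a ∈ Metric.ball (0 : ℂ) ρ₄, ∀ b ∈ Metric.ball (0 : ℂ) ρ₄,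
          G (a + s) = G (b + t) → a = 0 ∧ b = 0 := fun a ha b hb h =>
        hiso a (Metric.ball_subset_ball (min_le_left _ _) ha) b
          (Metric.ball_subset_ball (min_le_left _ _) hb) h
      have hev := hPos V J hJ2 hJs N ι hιe hιs hιd (fun z : ℂ => G (z + s))
        (fun z : ℂ => G (z + t)) (hGc s) (hGJc s) (hGc t) (hGJc t) h0 hreg' ρ₄ hρ₄ hiso'
        (fun n z => u n (z + s)) (fun n z => u n (z + t)) (fun n => huc n s)
        (fun n => huJc n s) (fun n => huc n t) (fun n => huJc n t) (hconvc s ρ₄) (hconvc t ρ₄)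
      obtain ⟨n, a, ha, b, hb, hab⟩ := hev.exists
      have heq : a + s = b + t := huinj n hab
      have h1 : s - t = b - a := by linear_combination heq
      have ha' : ‖a‖ < ‖s - t‖ / 2 :=
        lt_of_lt_of_le (mem_ball_zero_iff.1 ha) (min_le_right _ _)
      have hb' : ‖b‖ < ‖s - t‖ / 2 :=
        lt_of_lt_of_le (mem_ball_zero_iff.1 hb) (min_le_right _ _)
      have : ‖s - t‖ < ‖s - t‖ :=
        calc ‖s - t‖ = ‖b - a‖ := by rw [h1]
          _ ≤ ‖b‖ + ‖a‖ := norm_sub_le b a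
          _ < ‖s - t‖ / 2 + ‖s - t‖ / 2 := add_lt_add hb' ha'
          _ = ‖s - t‖ := by ring
      exact lt_irrefl _ this
    · -- same image germ: every nearby (regular) point has a partner near `s`
      have hρ : 0 < min (‖s - t‖ / 2) (r₁ - ‖s‖) :=
        lt_min hd (sub_pos.2 (mem_ball_zero_iff.1 hsB))
      obtain ⟨ρ', hρ', -, hsub⟩ := hco _ hρ
      have hρ'' : 0 < min (min (min ρ' (r₁ - ‖t‖)) (‖s - t‖ / 2)) ρr :=
        lt_min (lt_min (lt_min hρ' (sub_pos.2 (mem_ball_zero_iff.1 htB))) hd) hρr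
      refine ⟨_, hρ'', fun t' ht' => ?_⟩
      have ht'0 : t' ∈ Metric.ball t (min (min ρ' (r₁ - ‖t‖)) (‖s - t‖ / 2)) :=
        Metric.ball_subset_ball (min_le_left _ _) ht'
      have ht'r : t' ∈ Metric.ball t ρr := Metric.ball_subset_ball (min_le_right _ _) ht'
      have ht'1 : ‖t' - t‖ < ρ' := by
        have := Metric.ball_subset_ball ((min_le_left _ _).trans (min_le_left _ _)) ht'0
        rwa [Metric.mem_ball, dist_eq_norm] at this
      have ht'2 : ‖t' - t‖ < ‖s - t‖ / 2 := by
        have := Metric.ball_subset_ball (min_le_right _ _) ht'0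
        rwa [Metric.mem_ball, dist_eq_norm] at this
      have ht'B : t' ∈ B :=
        ball_sub_norm_subset_ball t r₁
          (Metric.ball_subset_ball ((min_le_left _ _).trans (min_le_right _ _)) ht'0)
      have hmem : G t' ∈ (fun z : ℂ => G (z + t)) '' Metric.ball (0 : ℂ) ρ' :=
        ⟨t' - t, mem_ball_zero_iff.2 ht'1, by simp only [sub_add_cancel]⟩
      obtain ⟨σ, hσ, hGσ⟩ := hsub hmem
      have hσ1 : ‖σ‖ < ‖s - t‖ / 2 :=
        lt_of_lt_of_le (mem_ball_zero_iff.1 hσ) (min_le_left _ _)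
      have hσ2 : ‖σ‖ < r₁ - ‖s‖ :=
        lt_of_lt_of_le (mem_ball_zero_iff.1 hσ) (min_le_right _ _)
      refine ⟨ht'B, hρreg t' ht'r, σ + s, ?_, ?_, hGσ⟩
      · rw [mem_ball_zero_iff]
        calc ‖σ + s‖ ≤ ‖σ‖ + ‖s‖ := norm_add_le _ _
          _ < (r₁ - ‖s‖) + ‖s‖ := by linarith
          _ = r₁ := by ring
      · intro h
        have h2 : s - t = (t' - t) - σ := by rw [← h]; ring
        have : ‖s - t‖ < ‖s - t‖ :=
          calc ‖s - t‖ = ‖(t' - t) - σ‖ := by rw [h2]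
            _ ≤ ‖t' - t‖ + ‖σ‖ := norm_sub_le _ _
            _ < ‖s - t‖ / 2 + ‖s - t‖ / 2 := add_lt_add ht'2 hσ1
            _ = ‖s - t‖ := by ring
        exact lt_irrefl _ this
  -- `N₂` is closed in the regular part of `B`
  have hNclosed : ∀ t ∈ B, Function.Injective (mfderiv 𝓘(ℝ, ℂ) (𝓡 4) G t) →
      t ∈ closure N₂ → t ∈ N₂ := by
    intro t htB hreg htcl
    obtain ⟨ρ, hρ, hinj⟩ := LI t hreg
    obtain ⟨tk, htkN, htk⟩ := mem_closure_iff_seq_limit.1 htcl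
    choose sk hsk using fun k => (htkN k).2.2
    have hskr : ∀ k, sk k ∈ Metric.closedBall (0 : ℂ) r₀ := fun k =>
      mem_closedBall_zero_iff.2 (O1 (sk k) (tk k) (mem_ball_zero_iff.1 (hsk k).1)
        (mem_ball_zero_iff.1 (htkN k).1) (hsk k).2.1 (hsk k).2.2).2
    obtain ⟨sstar, hsstar, φ, hφ, hlim⟩ :=
      (isCompact_closedBall (0 : ℂ) r₀).tendsto_subseq hskr
    have hcont : Continuous G := hGs.continuous
    have hGlim1 : Tendsto (fun k => G (sk (φ k))) atTop (𝓝 (G sstar)) :=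
      (hcont.tendsto _).comp hlim
    have htk' : Tendsto (fun k => tk (φ k)) atTop (𝓝 t) := htk.comp hφ.tendsto_atTop
    have hGlim2 : Tendsto (fun k => G (tk (φ k))) atTop (𝓝 (G t)) :=
      (hcont.tendsto _).comp htk'
    have heqfun : (fun k => G (sk (φ k))) = fun k => G (tk (φ k)) :=
      funext fun k => (hsk (φ k)).2.2
    rw [heqfun] at hGlim1
    have hGeq : G sstar = G t := tendsto_nhds_unique hGlim1 hGlim2
    by_cases hst : sstar = t
    · exfalso
      have h1 : ∀ᶠ k in atTop, sk (φ k) ∈ Metric.ball t ρ := by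
        rw [← hst]; exact hlim (Metric.ball_mem_nhds _ hρ)
      have h2 : ∀ᶠ k in atTop, tk (φ k) ∈ Metric.ball t ρ :=
        htk' (Metric.ball_mem_nhds _ hρ)
      obtain ⟨k, hk1, hk2⟩ := (h1.and h2).exists
      exact (hsk (φ k)).2.1 (hinj hk1 hk2 (hsk (φ k)).2.2)
    · exact ⟨htB, hreg, sstar, hr₀B hsstar, hst, hGeq⟩
  -- the critical points of `G` in the inner closed disc form a finite set `Zc`
  set Zc : Set ℂ := {c | c ∈ Metric.closedBall (0 : ℂ) r₀ ∧
    ¬ Function.Injective (mfderiv 𝓘(ℝ, ℂ) (𝓡 4) G c)} with hZcdef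
  have hZcfin : Zc.Finite := by
    have hRegO : IsOpen {t : ℂ | Function.Injective (mfderiv 𝓘(ℝ, ℂ) (𝓡 4) G t)} := by
      rw [Metric.isOpen_iff]
      intro t ht
      obtain ⟨ρ, hρ, hb⟩ := RegOpen t ht
      exact ⟨ρ, hρ, fun z hz => hb z hz⟩
    have hZccl : IsClosed Zc := Metric.isClosed_closedBall.inter hRegO.isClosed_compl
    have hZcK : IsCompact Zc :=
      (isCompact_closedBall (0 : ℂ) r₀).of_isClosed_subset hZccl fun c hc => hc.1
    set U : ℂ → Set ℂ := fun c =>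
      {z | z ≠ c → Function.Injective (mfderiv 𝓘(ℝ, ℂ) (𝓡 4) G z)} with hUdef
    have hU : ∀ c ∈ Zc, U c ∈ 𝓝 c := fun c _ => eventually_nhdsWithin_iff.1 (CI c)
    obtain ⟨tfin, htZ, hcover⟩ := hZcK.elim_nhds_subcover U hU
    refine tfin.finite_toSet.subset fun c hc => ?_
    obtain ⟨x, hx, hcx⟩ := Set.mem_iUnion₂.1 (hcover hc)
    have hcx' : c = x := by
      by_contra h
      exact hc.2 (hcx h)
    rw [hcx']
    exact hx
  -- the regular part of `B` is `B` minus `Zc`, hence preconnected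
  have hB'eq : {t | t ∈ B ∧ Function.Injective (mfderiv 𝓘(ℝ, ℂ) (𝓡 4) G t)} = B \ Zc := by
    ext t
    constructor
    · rintro ⟨htB, ht⟩
      exact ⟨htB, fun h => h.2 ht⟩
    · rintro ⟨htB, h⟩
      refine ⟨htB, ?_⟩
      by_cases hle : ‖t‖ ≤ r₀
      · by_contra hni
        exact h ⟨mem_closedBall_zero_iff.2 hle, hni⟩
      · exact himmA t (lt_of_not_ge hle) (mem_ball_zero_iff.1 htB)
  have hB'pre : IsPreconnected
      {t | t ∈ B ∧ Function.Injective (mfderiv 𝓘(ℝ, ℂ) (𝓡 4) G t)} := by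
    rw [hB'eq]
    exact (isPathConnected_ball_diff_finite (by linarith) hZcfin).isConnected.isPreconnected
  -- `N₂` is empty: clopen in the connected regular part of `B`, and it misses the collar
  have hNempty : ∀ t, t ∉ N₂ := by
    have hsub : {t | t ∈ B ∧ Function.Injective (mfderiv 𝓘(ℝ, ℂ) (𝓡 4) G t)} ⊆
        N₂ ∪ (closure N₂)ᶜ := by
      rintro t ⟨htB, hreg⟩
      by_cases h : t ∈ closure N₂
      · exact Or.inl (hNclosed t htB hreg h)
      · exact Or.inr h
    have hN₂open : IsOpen N₂ := Metric.isOpen_iff.2 hNopen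
    have hdisj : Disjoint N₂ (closure N₂)ᶜ :=
      Set.disjoint_compl_right_iff_subset.2 subset_closure
    rcases hB'pre.subset_or_subset hN₂open isClosed_closure.isOpen_compl hdisj hsub with h | h
    · exfalso
      have hξ₀B' : ξ₀ ∈ {t | t ∈ B ∧ Function.Injective (mfderiv 𝓘(ℝ, ℂ) (𝓡 4) G t)} :=
        ⟨mem_ball_zero_iff.2 hξ₀A.2, himmA ξ₀ hξ₀A.1 hξ₀A.2⟩
      obtain ⟨-, -, s, hsB, hsξ, hGsξ⟩ := h hξ₀B'
      have := (O1 s ξ₀ (mem_ball_zero_iff.1 hsB) hξ₀A.2 hsξ hGsξ).1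
      linarith [hξ₀A.1]
    · intro t ht
      exact h ⟨ht.1, ht.2.1⟩ (subset_closure ht)
  -- (7) every point of `B` is regular (no cusps)
  have hallreg : ∀ c ∈ B, Function.Injective (mfderiv 𝓘(ℝ, ℂ) (𝓡 4) G c) := by
    intro c hcB
    by_contra hc
    obtain ⟨ρc, hρc, hρcreg⟩ := CIball c
    set ρ₁ : ℝ := min ρc (r₁ - ‖c‖) with hρ₁def
    have hρ₁ : 0 < ρ₁ := lt_min hρc (sub_pos.2 (mem_ball_zero_iff.1 hcB))
    have hballB : Metric.ball c ρ₁ ⊆ B := fun z hz =>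
      ball_sub_norm_subset_ball c r₁ (Metric.ball_subset_ball (min_le_right _ _) hz)
    have hballreg : ∀ z ∈ Metric.ball c ρ₁, z ≠ c →
        Function.Injective (mfderiv 𝓘(ℝ, ℂ) (𝓡 4) G z) := fun z hz hzc =>
      hρcreg z (Metric.ball_subset_ball (min_le_left _ _) hz) hzc
    -- `G` is injective on `ball c ρ₁`: a double pair would put a regular point in `N₂`
    have hinjc : Set.InjOn G (Metric.ball c ρ₁) := by
      intro a ha b hb hab
      by_contra hne
      by_cases hac : a = c
      · have hbc : b ≠ c := fun h => hne (hac.trans h.symm)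
        exact hNempty b ⟨hballB hb, hballreg b hb hbc, a, hballB ha, hne, hab⟩
      · exact hNempty a ⟨hballB ha, hballreg a ha hac, b, hballB hb, fun h => hne h.symm,
          hab.symm⟩
    have hinj' : Set.InjOn (fun z : ℂ => G (z + c)) (Metric.ball (0 : ℂ) ρ₁) := by
      intro a ha b hb hab
      have ha' : a + c ∈ Metric.ball c ρ₁ := by
        simpa [Metric.mem_ball, dist_eq_norm] using ha
      have hb' : b + c ∈ Metric.ball c ρ₁ := by
        simpa [Metric.mem_ball, dist_eq_norm] using hb
      exact add_right_cancel (hinjc ha' hb' hab)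
    have himm' : ∀ z ∈ Metric.ball (0 : ℂ) ρ₁, z ≠ 0 →
        Function.Injective (mfderiv 𝓘(ℝ, ℂ) (𝓡 4) (fun z : ℂ => G (z + c)) z) := by
      intro z hz hz0
      rw [mfderiv_comp_add_const hGs]
      refine hballreg (z + c) ?_ ?_
      · simpa [Metric.mem_ball, dist_eq_norm] using hz
      · simpa using hz0
    have key := hCusp V J hJ2 hJs N ι hιe hιs hιd (fun z : ℂ => G (z + c)) (hGc c) (hGJc c)
      ρ₁ hρ₁ hinj' himm' (fun n z => u n (z + c)) (fun n => huc n c) (fun n => huJc n c)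
      (fun n => huinjc n c) (fun n => huimmc n c) (hconvc c ρ₁)
    rw [mfderiv_comp_add_const hGs, zero_add] at key
    exact hc key
  -- conclusion
  refine ⟨?_, fun ξ hξ => hallreg ξ hξ⟩
  intro s hs t ht hG
  by_contra hne
  exact hNempty t ⟨ht, hallreg t ht, s, hs, hne, hG⟩

end Literature.Geometry.Symplectic
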